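import Literature.NumberTheory.Rogawski1990.ArchHCSpaceGInnerTransport   -- ★ p851918 (this seat): `archHCSpaceG_of_signRefinement`, `archHCSpaceG_innerTransport(_of_archHCSpaceG)`, slot-sign bookkeeping
import HarnessLib

/-!
# FORWARD (N8-INNER brick (6)), riders: scalar closure of Harish-Chandra's space and the consumer-keyed J′-slot

Topic `NumberTheory/Rogawski1990`; namespace `Literature.NumberTheory.Rogawski1990`.  THEOREMS ONLY (no `def`,
no instance, no notation, no axiom, no named fact, no `sorry`).  Cell `pub/hodgecm-mathlib`, crux H413
(`stmt-HodgeConjecture-24833`), road «N8-INNER» (row 2 `stub_N8`), riders of ★ `ArchHCSpaceGInnerTransport`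
asked by the junction hands:

* §1 **`archHCSpaceG_const_mul`** — `F ∈ ArchHCSpaceG s jc′ ⟹ κ • F ∈ ArchHCSpaceG s jc′` (every clause of
  Harish-Chandra's∕Bouaziz's space is linear; the one-sided limits and the jump relations are read where the
  `ρ`-twisted family is smooth: on `RegG` along the normal ★ `eventually_add_smul_hcNrm_mem_regG`, and at the
  Cayley point ★ `hcCayPt_mem_inRegG_insert`).  Consumer: the R-726 MULTIPLICITY — at a definite place of the
  inner form `G′ = U(diag α)` the stable class of a regular chart point is ONE `U(3)`-class, on the quasi-split
  side THREE `U(2,1)`-classes, so the transported ordinary family whose `stableSumG` reads the `G′`-stable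
  orbital integral is `3^{−#definite places} • orbFamGExt L α ν′ a′`: `archHCSpaceG_innerTransport_const_mul`.
* §2 **the consumer-keyed J′-slot** (LH1-p01 (g12), brick (5)): the sign-refinement lemma with the agreement
  of constants `jc″ = jc′` asked ONLY on the walls whose Cayley chart family is not identically zero —
  for `orbFamGExt` that is: ADMISSIBLE label `S′ ⊆ splitChartPlaces L α`, INDEFINITE place `w`, NONCOMPACT pair
  `(i, j)`; `archHCSpaceG_of_signRefinement'`, `archHCSpaceG_innerTransport_of_archHCSpaceG'`,
  `archHCSpaceG_innerTransport_slot'` (also rescaled by `κ`).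

References: D. Shelstad, *Characters and inner forms of a quasi-split group over ℝ*, Compositio Math. 39
(1979) §4; A. Bouaziz, *Intégrales orbitales sur les groupes de Lie réductifs*, Ann. Sci. ÉNS 27 (1994)
§3.1–3.2; J. Rogawski, *Automorphic Representations of Unitary Groups in Three Variables* (1990) §14.2,
§3.7 Prop. 3.7.1 (stable classes inside a Cartan).
-/

set_option autoImplicit false

noncomputable section

open MeasureTheory MeasureTheory.Measure NumberField NumberField.InfinitePlace Matrix Complex Set Filter Topology
open scoped MatrixGroups Matrix ContDiff Classical
open Literature.NumberTheory.Automorphic Literature.NumberTheory.Automorphic.UnitaryGroup Literature.NumberTheory.Automorphic.ArchCartan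
open Literature.NumberTheory.Automorphic.Shelstad1979.StableOrbitalIntegrals
open Literature.NumberTheory.GaloisRepresentations

namespace Literature.NumberTheory.Rogawski1990

/-! ## §1 Scalar closure of `ArchHCSpaceG` and the RESCALED forward family (ref5 R-726 rider: at an `α`-definite place the `G′`-stable class is ONE class, the
`β`-side stable class THREE, so the READ of the junction wants `3^{−#definite places} • orbFamGExt`) -/

section ConstMul

variable {W : Type*} [Fintype W] [DecidableEq W]

/-- **The `ρ`-twisted jet of a scalar multiple**, at a point where the twisted family is `C^∞`:
`Dⁿ(eρ · (κ F)) = κ · Dⁿ(eρ · F)`. [cite: HormanderALPDO1, §1.1 (1.1.9) p. 12] [cite: Shelstad1979, §4 p. 24] -/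
theorem hcTwistedDeriv_const_mul_of_contDiffAt (S' : Finset W) (κ : ℂ) {F : (W → Fin 3 → ℝ) → ℂ}
    {c : W → Fin 3 → ℝ} {n : ℕ} (hF : ContDiffAt ℝ n (fun c => archERhoG S' c * F c) c)
    (dirs : Fin n → (W → Fin 3 → ℝ)) :
    hcTwistedDeriv S' n dirs (fun c => κ * F c) c = κ * hcTwistedDeriv S' n dirs F c := by
  unfold hcTwistedDeriv
  have hfun : (fun c => archERhoG S' c * (κ * F c)) = fun c => κ • (archERhoG S' c * F c) := by
    funext c'
    rw [smul_eq_mul]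
    ring
  rw [hfun, iteratedFDeriv_const_smul_apply' hF, _root_.smul_apply, smul_eq_mul]

/-- **On the in-regular set the twisted family of a member is `C^∞` at every point.** [cite: Bouaziz1994IntegralesOrbitales, §3.1 (I₂) p. 579] -/
theorem ArchHcSmoothOneSided.contDiffAt_archERhoG_mul {s : W → Fin 3 → SignType} {F : Finset W → (W → Fin 3 → ℝ) → ℂ}
    (hS : ArchHcSmoothOneSided s F) (S' : Finset W) {c : W → Fin 3 → ℝ} (hc : c ∈ InRegG s S') (n : ℕ) :
    ContDiffAt ℝ n (fun c => archERhoG S' c * F S' c) c :=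
  ((((contDiff_archERhoG S').contDiffOn.mul (hS S').1).contDiffAt ((isOpen_inRegG s S').mem_nhds hc))).of_le
    (by exact_mod_cast le_top)

/-- **Along the normal of a semiregular wall point the twisted jets of `κ F` are `κ ·` those of `F`, for small
`ν ≠ 0`** (the normal curve runs in `RegG S′ ⊆ InRegG s S′`). [cite: Shelstad1979, Prop. 4.5 (p. 26)] [cite: Varadarajan1977, I §1.12] -/
theorem hcTwistedDeriv_const_mul_add_smul_hcNrm_eventuallyEq {s : W → Fin 3 → SignType}
    {F : Finset W → (W → Fin 3 → ℝ) → ℂ} (hS : ArchHcSmoothOneSided s F) (κ : ℂ) {S' : Finset W} {w : W}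
    (hw : w ∉ S') {i j : Fin 3} (hij : i ≠ j) {p : W → Fin 3 → ℝ} (hp : HcSemireg S' w i j p) (n : ℕ)
    (dirs : Fin n → (W → Fin 3 → ℝ)) :
    (fun ν : ℝ => hcTwistedDeriv S' n dirs (fun c => κ * F S' c) (p + ν • hcNrm w i j)) =ᶠ[𝓝[≠] (0 : ℝ)]
      fun ν : ℝ => κ * hcTwistedDeriv S' n dirs (F S') (p + ν • hcNrm w i j) := by
  filter_upwards [eventually_add_smul_hcNrm_mem_regG hw hij hp] with ν hν
  exact hcTwistedDeriv_const_mul_of_contDiffAt S' κ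
    (hS.contDiffAt_archERhoG_mul S' (regG_subset_inRegG s S' hν) n) dirs

/-- **SCALAR CLOSURE OF HARISH-CHANDRA'S SPACE**: `F ∈ ArchHCSpaceG s jc′ ⟹ κ • F ∈ ArchHCSpaceG s jc′` for every
constant `κ : ℂ` (all five clauses are linear in `F` for fixed `s`, `jc′`; the one-sided limits and the jump
relations are read where the twisted family is smooth — on `RegG` along the normal and at the Cayley point).
[cite: Bouaziz1994IntegralesOrbitales, §3.2 p. 580 (I(U) is a vector space)] [cite: Shelstad1979, §4 (I)–(III) pp. 22–26] -/
theorem archHCSpaceG_const_mul {s : W → Fin 3 → SignType} {jc' : Finset W → W → Fin 3 → Fin 3 → ℂ}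
    {F : Finset W → (W → Fin 3 → ℝ) → ℂ} (κ : ℂ) (hF : ArchHCSpaceG s jc' F) :
    ArchHCSpaceG s jc' (fun S' c => κ * F S' c) := by
  obtain ⟨hP, hW, hS, hC, hJ⟩ := hF
  refine ⟨?_, ⟨?_, ?_⟩, fun S' => ⟨?_, ?_, ?_⟩, ?_, ?_⟩
  · intro S' c w i k hwi
    show κ * F S' (c + angleShift w i k) = κ * F S' c
    rw [hP S' c w i k hwi]
  · intro S' c w i j hw hij hs
    show κ * F S' (hcSwapAt w i j c) * archRG S' c = archRG S' (hcSwapAt w i j c) * (κ * F S' c)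
    have h := hW.1 S' c w i j hw hij hs
    calc κ * F S' (hcSwapAt w i j c) * archRG S' c = κ * (F S' (hcSwapAt w i j c) * archRG S' c) := by ring
      _ = κ * (archRG S' (hcSwapAt w i j c) * F S' c) := by rw [h]
      _ = archRG S' (hcSwapAt w i j c) * (κ * F S' c) := by ring
  · intro S' c w hw
    show κ * F S' (negXAt w c) = κ * F S' c
    rw [hW.2 S' c w hw]
  · exact contDiffOn_const.mul (hS S').1
  · intro n K hK
    obtain ⟨B, hB⟩ := (hS S').2.1 n K hK
    refine ⟨‖κ‖ * B, ?_⟩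
    rintro _ ⟨c, hc, rfl⟩
    have hca : ContDiffAt ℝ n (F S') c :=
      (((hS S').1.contDiffAt ((isOpen_inRegG s S').mem_nhds hc.2))).of_le (by exact_mod_cast le_top)
    have hfun : (fun c => κ * F S' c) = fun c => κ • F S' c := by
      funext c'; rw [smul_eq_mul]
    show ‖iteratedFDeriv ℝ n (fun c => κ * F S' c) c‖ ≤ ‖κ‖ * B
    rw [hfun, iteratedFDeriv_const_smul_apply' hca, norm_smul]
    exact mul_le_mul_of_nonneg_left (hB ⟨c, hc, rfl⟩) (norm_nonneg κ)
  · intro w hw i j hij hs p hp n m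
    obtain ⟨Lp, Lm, hLp, hLm⟩ := (hS S').2.2 w hw i j hij hs p hp n m
    have hev := hcTwistedDeriv_const_mul_add_smul_hcNrm_eventuallyEq hS κ hw hij hp n
      (fun r => hcAdaptedVec w i j (m r))
    refine ⟨κ * Lp, κ * Lm, ?_, ?_⟩
    · exact (hLp.const_mul κ).congr' (hev.filter_mono (nhdsWithin_mono _ fun x (hx : 0 < x) => ne_of_gt hx)).symm
    · exact (hLm.const_mul κ).congr' (hev.filter_mono (nhdsWithin_mono _ fun x (hx : x < 0) => ne_of_lt hx)).symm
  · intro S'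
    obtain ⟨Rb, hRb⟩ := hC S'
    exact ⟨Rb, fun c hc => by show κ * F S' c = 0; rw [hRb c hc, mul_zero]⟩
  · intro S' w hw i j hij hs p hp n m
    have h := hJ S' w hw i j hij hs p hp n m
    have hev := hcTwistedDeriv_const_mul_add_smul_hcNrm_eventuallyEq hS κ hw hij hp n
      (fun r => hcAdaptedVec w i j (m r))
    -- the Cayley-side reading scales by `κ` (the Cayley point is in-regular on the split chart)
    have hcay : hcTwistedDeriv (insert w S') n (fun r => hcCayVec w i j (m r)) (fun c => κ * F (insert w S') c)
        (hcCayPt w i j p) = κ * hcTwistedDeriv (insert w S') n (fun r => hcCayVec w i j (m r)) (F (insert w S'))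
          (hcCayPt w i j p) :=
      hcTwistedDeriv_const_mul_of_contDiffAt (insert w S') κ
        (hS.contDiffAt_archERhoG_mul (insert w S') (hcCayPt_mem_inRegG_insert s hp) n) _
    obtain ⟨Lp, Lm, hLp, hLm, hJeq⟩ := h
    refine ⟨κ * Lp, κ * Lm, ?_, ?_, ?_⟩
    · exact (hLp.const_mul κ).congr' (hev.filter_mono (nhdsWithin_mono _ fun x (hx : 0 < x) => ne_of_gt hx)).symm
    · exact (hLm.const_mul κ).congr' (hev.filter_mono (nhdsWithin_mono _ fun x (hx : x < 0) => ne_of_lt hx)).symm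
    · rw [hcay, ← mul_sub, hJeq]
      ring

end ConstMul

section HeadScaled

variable (L : Type) [Field L] [NumberField L] [IsCMField L] (α : Fin 3 → L)
  [MeasurableSpace ↥(arch (↥(maximalRealSubfield L)) L (IsCMField.complexConj L) 3 (Matrix.diagonal α))]
  [BorelSpace ↥(arch (↥(maximalRealSubfield L)) L (IsCMField.complexConj L) 3 (Matrix.diagonal α))]
  (ν' : Measure ↥(arch (↥(maximalRealSubfield L)) L (IsCMField.complexConj L) 3 (Matrix.diagonal α)))
  [ν'.IsHaarMeasure] [ν'.IsMulRightInvariant]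

/-- **FORWARD, RESCALED (the R-726 multiplicity).**  For every constant `κ : ℂ` — the junction takes
`κ = 3^{−#{definite places of α}}`, the ratio of the stable-class counts `|S₃∕W_s| = 1` (`U(3)`) vs `3`
(`U(2,1)`) read through the s-free `stableSumG` — the rescaled transported family `κ • orbFamGExt L α ν′ a′`
lies in `ArchHCSpaceG (slotSign L β) jc″` whenever the unscaled one lies in `ArchHCSpaceG (slotSign L α) jc′`
and `jc″` agrees with `jc′` at the split-chart places of `α`. [cite: Shelstad1979, §4 (II)–(III) pp. 23–26, Prop. 4.5 (p. 26)]
[cite: Rogawski1990, §14.2 (14.2.1) pp. 232–233; §3.7 Prop. 3.7.1 pp. 29–30] -/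
theorem archHCSpaceG_innerTransport_const_mul_of_archHCSpaceG (hα : ∀ i, α i ≠ 0)
    (hreal : ∀ (w : {w : InfinitePlace L // IsComplex w}) (k : Fin 3), (w.1.embedding (α k)).im = 0) (κ : ℂ)
    {jc' jc'' : Finset {w : InfinitePlace L // IsComplex w} → {w : InfinitePlace L // IsComplex w} → Fin 3 → Fin 3 → ℂ}
    (hjc : ∀ (S' : Finset {w : InfinitePlace L // IsComplex w}) (w : {w : InfinitePlace L // IsComplex w}) (i j : Fin 3),
      w ∉ S' → w ∈ splitChartPlaces L α → jc'' S' w i j = jc' S' w i j)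
    {a' : ↥(arch (↥(maximalRealSubfield L)) L (IsCMField.complexConj L) 3 (Matrix.diagonal α)) → ℂ}
    (ha' : ArchHCSpaceG (slotSign L α) jc' (orbFamGExt L α ν' a')) :
    ArchHCSpaceG (slotSign L ![(2 : L)⁻¹, 1, -(2 : L)⁻¹]) jc''
      (fun S' c => κ * orbFamGExt L α ν' a' S' c) :=
  archHCSpaceG_const_mul κ (archHCSpaceG_innerTransport_of_archHCSpaceG L α ν' hα hreal hjc ha')

/-- **FORWARD, RESCALED — head form.**  `∃ jc′, ∀ a′ ∈ C_c^∞(G′_∞), κ • orbFamGExt L α ν′ a′ ∈ ArchHCSpaceG (slotSign L β) jc′`,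
for every constant `κ`. [cite: Shelstad1979, §4 Thm. 4.7 (p. 31)] [cite: Rogawski1990, §14.2 (14.2.1) pp. 232–233] -/
theorem archHCSpaceG_innerTransport_const_mul
    (hherm : ((Matrix.diagonal α).map (cmConjRingHom L)).transpose = Matrix.diagonal α) (hα : ∀ i, α i ≠ 0) (κ : ℂ) :
    ∃ jc' : Finset {w : InfinitePlace L // IsComplex w} → {w : InfinitePlace L // IsComplex w} → Fin 3 → Fin 3 → ℂ,
      ∀ a' : ↥(arch (↥(maximalRealSubfield L)) L (IsCMField.complexConj L) 3 (Matrix.diagonal α)) → ℂ,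
        ArchSmooth L 3 (Matrix.diagonal α) a' →
          ArchHCSpaceG (slotSign L ![(2 : L)⁻¹, 1, -(2 : L)⁻¹]) jc' (fun S' c => κ * orbFamGExt L α ν' a' S' c) := by
  obtain ⟨jc', hjc'⟩ := archHCSpaceG_innerTransport L α ν' hherm hα
  exact ⟨jc', fun a' ha' => archHCSpaceG_const_mul κ (hjc' a' ha')⟩

end HeadScaled

/-! ## §2 The CONSUMER-KEYED J′-slot (LH1-p01 (g12) re-cut 15:47:07Z): the constants need agree
only on the walls whose Cayley chart family is NOT identically zero, i.e. on ADMISSIBLE labels at INDEFINITE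
places and NONCOMPACT pairs — exactly what (5) J′-TRANSPORT delivers -/

section SignRefinementKeyed

variable {W : Type*} [Fintype W] [DecidableEq W]

/-- **SIGN REFINEMENT, consumer-keyed constants.**  As `archHCSpaceG_of_signRefinement`, but the agreement
`jc″ = jc′` is asked only on the `s`-noncompact walls `(S′, w, i, j)` whose Cayley chart family
`F (insert w S′)` is not identically zero (elsewhere both jump prescriptions read `· 0 = 0`).
[cite: Shelstad1979, §4 (II)–(III) pp. 23–26, Prop. 4.5 (p. 26)] [cite: Bouaziz1994IntegralesOrbitales, §3.2 (I₃) p. 580] -/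
theorem archHCSpaceG_of_signRefinement' {s s' : W → Fin 3 → SignType}
    {jc' jc'' : Finset W → W → Fin 3 → Fin 3 → ℂ} {F : Finset W → (W → Fin 3 → ℝ) → ℂ}
    (hcomp : ∀ (w : W) (i j : Fin 3), s' w i = s' w j → s w i = s w j)
    (hjc : ∀ (S' : Finset W) (w : W) (i j : Fin 3), w ∉ S' → i ≠ j → s w i ≠ s w j →
      F (insert w S') ≠ (fun _ => 0) → jc'' S' w i j = jc' S' w i j)
    (hzero : ∀ (S' : Finset W) (w : W) (i j : Fin 3), w ∉ S' → i ≠ j → s' w i ≠ s' w j → s w i = s w j →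
      F (insert w S') = fun _ => 0)
    (hF : ArchHCSpaceG s jc' F) : ArchHCSpaceG s' jc'' F := by
  obtain ⟨hP, hW, hS, hC, hJ⟩ := hF
  refine ⟨hP, ⟨fun S' c w i j hw hij hs' => hW.1 S' c w i j hw hij (hcomp w i j hs'), hW.2⟩,
    fun S' => ⟨?_, ?_, ?_⟩, hC, ?_⟩
  · exact (hS S').1.mono (inRegG_subset_inRegG_of_signRefinement hcomp S')
  · intro n K hK
    exact ((hS S').2.1 n K hK).mono
      (image_mono (inter_subset_inter_right _ (inRegG_subset_inRegG_of_signRefinement hcomp S')))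
  · intro w hw i j hij hs' p hp n m
    by_cases hs : s w i = s w j
    · have hpin : p ∈ InRegG s S' := hp.mem_inRegG_of_eq hij hs
      exact ⟨_, _, (tendsto_hcTwistedDeriv_add_smul_of_mem_inRegG hS S' hpin _ n _).mono_left nhdsWithin_le_nhds,
        (tendsto_hcTwistedDeriv_add_smul_of_mem_inRegG hS S' hpin _ n _).mono_left nhdsWithin_le_nhds⟩
    · exact (hS S').2.2 w hw i j hij hs p hp n m
  · intro S' w hw i j hij hs' p hp n m
    by_cases hs : s w i = s w j
    · have hpin : p ∈ InRegG s S' := hp.mem_inRegG_of_eq hij hs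
      have h0 : F (insert w S') = fun _ => 0 := hzero S' w i j hw hij hs' hs
      refine ⟨_, _, (tendsto_hcTwistedDeriv_add_smul_of_mem_inRegG hS S' hpin _ n _).mono_left nhdsWithin_le_nhds,
        (tendsto_hcTwistedDeriv_add_smul_of_mem_inRegG hS S' hpin _ n _).mono_left nhdsWithin_le_nhds, ?_⟩
      rw [sub_self, h0, hcTwistedDeriv_fun_zero, mul_zero]
    · by_cases h0 : F (insert w S') = fun _ => 0
      · -- both prescriptions read `· 0`
        obtain ⟨Lp, Lm, h1, h2, h3⟩ := hJ S' w hw i j hij hs p hp n m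
        refine ⟨Lp, Lm, h1, h2, ?_⟩
        rw [h0, hcTwistedDeriv_fun_zero, mul_zero] at h3 ⊢
        exact h3
      · rw [hjc S' w i j hw hij hs h0]
        exact hJ S' w hw i j hij hs p hp n m

end SignRefinementKeyed

section HeadKeyed

variable (L : Type) [Field L] [NumberField L] [IsCMField L] (α : Fin 3 → L)
  [MeasurableSpace ↥(arch (↥(maximalRealSubfield L)) L (IsCMField.complexConj L) 3 (Matrix.diagonal α))]
  [BorelSpace ↥(arch (↥(maximalRealSubfield L)) L (IsCMField.complexConj L) 3 (Matrix.diagonal α))]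
  (ν' : Measure ↥(arch (↥(maximalRealSubfield L)) L (IsCMField.complexConj L) 3 (Matrix.diagonal α)))
  [ν'.IsHaarMeasure] [ν'.IsMulRightInvariant]

/-- **FORWARD with the CONSUMER-KEYED J′-slot** (LH1-p01's token, the shape ★ (5) J′-TRANSPORT delivers): `jc″`
need agree with `jc′` only at `(S′, w, i, j)` with `S′` an ADMISSIBLE label of `α`, `w ∉ S′` a split-chart
(indefinite) place of `α`, and `(i, j)` a NONCOMPACT pair of `slotSign L α w`; everywhere else (labels meeting a
definite place, compact pairs, definite places) `jc″` is free. [cite: Shelstad1979, §4 Prop. 4.5 (p. 26)]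
[cite: Rogawski1990, §14.2 (14.2.1) pp. 232–233] -/
theorem archHCSpaceG_innerTransport_of_archHCSpaceG' (hα : ∀ i, α i ≠ 0)
    (hreal : ∀ (w : {w : InfinitePlace L // IsComplex w}) (k : Fin 3), (w.1.embedding (α k)).im = 0)
    {jc' jc'' : Finset {w : InfinitePlace L // IsComplex w} → {w : InfinitePlace L // IsComplex w} → Fin 3 → Fin 3 → ℂ}
    (hjc : ∀ (S' : Finset {w : InfinitePlace L // IsComplex w}) (w : {w : InfinitePlace L // IsComplex w}) (i j : Fin 3),
      (∀ v ∈ S', v ∈ splitChartPlaces L α) → w ∉ S' → w ∈ splitChartPlaces L α → i ≠ j →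
        slotSign L α w i ≠ slotSign L α w j → jc'' S' w i j = jc' S' w i j)
    {a' : ↥(arch (↥(maximalRealSubfield L)) L (IsCMField.complexConj L) 3 (Matrix.diagonal α)) → ℂ}
    (ha' : ArchHCSpaceG (slotSign L α) jc' (orbFamGExt L α ν' a')) :
    ArchHCSpaceG (slotSign L ![(2 : L)⁻¹, 1, -(2 : L)⁻¹]) jc'' (orbFamGExt L α ν' a') := by
  refine archHCSpaceG_of_signRefinement' (slotSign_eq_of_slotSign_quasiSplitWeights_eq L α hα hreal)
    (fun S' w i j hw hij hs hne => ?_) (fun S' w i j _ _ hs' hs => ?_) ha'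
  · -- the Cayley label `insert w S′` is admissible (else its family is `0`), hence so are `S′` and `w`
    have hadm : ∀ v, v ∈ insert w S' → v ∈ splitChartPlaces L α := by
      by_contra h
      exact hne (orbFamGExt_of_not_admissible L α ν' a' (insert w S') h)
    exact hjc S' w i j (fun v hv => hadm v (Finset.mem_insert_of_mem hv)) hw
      (hadm w (Finset.mem_insert_self w S')) hij hs
  · have hw' : w ∉ splitChartPlaces L α :=
      not_mem_splitChartPlaces_of_slotSign_eq_of_quasiSplitWeights_ne L α hα hs' hs
    exact orbFamGExt_of_not_admissible L α ν' a' (insert w S') fun h => hw' (h w (Finset.mem_insert_self w S'))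

/-- **FORWARD, consumer-keyed slot — head form** (`∃ jc′` from letter L1 of CUT B, then every consumer-keyed
`jc″` works); also RESCALED by an arbitrary constant `κ` (the R-726 multiplicity `3^{−#definite}`).
[cite: Shelstad1979, §4 Thm. 4.7 (p. 31), Prop. 4.5 (p. 26)] [cite: Rogawski1990, §14.2 (14.2.1) pp. 232–233] -/
theorem archHCSpaceG_innerTransport_slot'
    (hherm : ((Matrix.diagonal α).map (cmConjRingHom L)).transpose = Matrix.diagonal α) (hα : ∀ i, α i ≠ 0) (κ : ℂ) :
    ∃ jc' : Finset {w : InfinitePlace L // IsComplex w} → {w : InfinitePlace L // IsComplex w} → Fin 3 → Fin 3 → ℂ,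
      ∀ a' : ↥(arch (↥(maximalRealSubfield L)) L (IsCMField.complexConj L) 3 (Matrix.diagonal α)) → ℂ,
        ArchSmooth L 3 (Matrix.diagonal α) a' →
          ∀ jc'' : Finset {w : InfinitePlace L // IsComplex w} → {w : InfinitePlace L // IsComplex w} → Fin 3 → Fin 3 → ℂ,
            (∀ (S' : Finset {w : InfinitePlace L // IsComplex w}) (w : {w : InfinitePlace L // IsComplex w}) (i j : Fin 3),
                (∀ v ∈ S', v ∈ splitChartPlaces L α) → w ∉ S' → w ∈ splitChartPlaces L α → i ≠ j →
                  slotSign L α w i ≠ slotSign L α w j → jc'' S' w i j = jc' S' w i j) →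
              ArchHCSpaceG (slotSign L ![(2 : L)⁻¹, 1, -(2 : L)⁻¹]) jc''
                (fun S' c => κ * orbFamGExt L α ν' a' S' c) := by
  obtain ⟨jc', hjc'⟩ := exists_jc_archHCSpaceG_orbFamGExt_of_ne_zero L α ν' hherm hα
  have hreal : ∀ (w : {w : InfinitePlace L // IsComplex w}) (k : Fin 3), (w.1.embedding (α k)).im = 0 :=
    fun w k => im_embedding_diagonal_eq_zero L 3 α (complexConj_apply_eq_of_diagonal_frame hherm) w k
  exact ⟨jc', fun a' ha' jc'' hjc =>
    archHCSpaceG_const_mul κ (archHCSpaceG_innerTransport_of_archHCSpaceG' L α ν' hα hreal hjc (hjc' a' ha'))⟩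

end HeadKeyed

end Literature.NumberTheory.Rogawski1990

end
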